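import Literature.NumberTheory.Automorphic.AutomorphicTwist
import Literature.NumberTheory.Automorphic.UnramifiedHeckeLevel
import Literature.NumberTheory.Automorphic.AutomorphicLFunction
import HarnessLib

/-!
# Satake parameters of twists: `t_{π ⊗ χ, v} = χ(ϖ_v) t_{π,v}`

Companion of `Literature.NumberTheory.Automorphic.AutomorphicTwist` (the twist `π ⊗ χ` of a
cuspidal automorphic representation of `GL_n(𝔸_K)` by a unitary Hecke character, realised as
the subspace `M_{(χ∘det)⁻¹}(π)` of `L²_cusp`), and sixth layer of the decomposition of the named
fact `Literature.NumberTheory.Automorphic.exists_cuspidal_baseChange_of_not_dvd` (**lang.S23**; Arthur–Clozel (1989), Ch. 3).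
Everything here is **proved**; there is no new definition and no new named fact.

In the proof of Thm. 3.1 of Arthur–Clozel, Ch. 3 (p. 172) the local factor of
`L^S(s, π ⊗ π̃' ⊗ ηⁱ)` at a finite `v ∉ S` is `det(1 - t_v ⊗ t̃'_v ζ_vⁱ q_v^{-s})⁻¹` with
`ζ_v = η(ϖ_v)`: the Hecke matrix of the twist `π ⊗ η` at an unramified place is
`t_{π ⊗ η, v} = η(ϖ_v) t_{π,v}`. This file proves that statement for the tree's notions:

* `ContRepresentation.ClosedSubrep.heckeOperatorAt_twist_twistEquiv` (generic `G`): for an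
  automorphic character `ψ` trivial on the level `Kf` and a `Kf`-fixed `f ∈ W`,
  `[Kf g Kf](ψ̄ f) = ψ(g)⁻¹ ψ̄ [Kf g Kf] f` — each left coset `x Kf ⊆ Kf g Kf` contributes
  `R(x)(ψ̄ f) = ψ(x)⁻¹ ψ̄ R(x) f` (`rightRegular_mulL2`) and `ψ(x) = ψ(g)`
  (`AutomorphicCharacter.apply_eq_of_mk_mem_orbit`); a common transversal evaluates both
  operators (`heckeOperator_apply_eq_sum`), and in the junk case of an infinite double coset
  both vanish (`heckeOperator_eq_zero_of_infinite`). Also `twistEquiv_mem_fixedVectors`.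
* `HasSatakeParameterAt.twist` (`GL_n`): if `ψ(t_{v,i}) = zⁱ` (`0 ≤ i ≤ n`) then a Satake
  parameter `α` of `W` at `v` (level `Kf`, uniformizer `ϖ`) gives the Satake parameter `z⁻¹ α` of
  `M_ψ(W)` (homogeneity `e_i(c α) = cⁱ e_i(α)`, `esymm_map_const_mul`).
* Determinants (**proved**, folklore): `det_glDiagonal`, `det_heckeDiagAt`
  (`det t_{v,i} = ϖ_vⁱ` as an idele, `i ≤ n`), `GLn.det_ofLocal` (`det ι_v(g) = (det g)_v`),
  `map_inr_uniformizerIdele` (the idele of `GLnAdelicStructure` is `localUnits v ϖ` of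
  `HeckeCharacter`), and `HeckeCharacter.isUnramifiedAt_of_level`: if `χ ∘ det` is trivial on
  `K(𝔪)` (`𝔪 ≠ 0`, `n ≥ 1`) then `χ` is unramified at every `v ∤ 𝔪`.
* `CuspidalAutomorphicRepGL.hasSatakeParameterAt_twistByChar`: for `χ ∘ det` trivial on `K(𝔫)`,
  a Satake parameter `α` of `π` at `v` (level `K(𝔫)`, uniformizer `ϖ`) gives the Satake parameter
  `χ_v(ϖ) · α` of `π ⊗ χ` (same level, same uniformizer), `χ_v(ϖ) = χ(localUnits v ϖ)`.
* `IsSatakeFamilyOf.twistByChar`: for `χ` of level `𝔪` and `S ⊇ supp 𝔪`, a Satake family `α`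
  of `π` away from `S` gives the Satake family `v ↦ χ.valueAtUniformizer v · α v` of `π ⊗ χ`
  away from `S` (pass to level `K(𝔫𝔪)` by `HasSatakeParameterAt.of_level_le` of
  `UnramifiedHeckeLevel`; independence of the uniformizer by
  `HeckeCharacter.localComponent_eq_valueAtUniformizer`, `χ` being unramified at `v ∤ 𝔪`).
* Non-vanishing and a first consequence of `π ⊗ η = π` (**proved**): the Hecke operator of a
  central element is `ρ(t)` on fixed vectors (`heckeOperator_apply_of_mem_center`), `t_{v,n}` is
  central (`heckeDiagAt_self_mem_center`), hence `e_n(α) ≠ 0` and `0 ∉ α` for every Satake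
  parameter (`HasSatakeParameterAt.esymm_ne_zero`, `.zero_not_mem`); and
  `CuspidalAutomorphicRepGL.pow_eq_one_of_twistByChar_eq`: under
  `Flath1979_heckeOperatorAt_ofLocal_eq_smul`, `π ⊗ η = π` with `η ∘ det` trivial on `K(𝔪)`
  forces `η_v(ϖ)ⁿ = 1` at every `v ∤ 𝔪` where `π` has a Satake parameter — the shadow of
  "`π ≅ π ⊗ η`, `η` of prime order `l` ⟹ `l ∣ n`" in Arthur–Clozel, Ch. 3, Thm. 4.2 (b).

## Design notes

* Hypotheses are the weakest the computation uses: `ψ` trivial on the level (for `χ ∘ det`: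
  `χ (det k) = 1` for `k ∈ K(𝔫)`), no conductor theory. A finite-order `χ` has *some* such
  level `𝔪` (continuity of `χ` and the neighbourhood basis `det K(𝔪)` of `1` in the finite
  ideles); that existence statement is not needed here and is left to the consumer.
* What this still does not give towards Arthur–Clozel's Thm. 4.2: the class field character `η`
  of `E/F` itself ("a character of `𝔸^*` vanishing exactly on `F^* N(𝔸_E^*)`", p. 173), whose
  definition needs the idelic norm `N : 𝔸_E^* → 𝔸_F^*`, i.e. functoriality of
  `NumberField.AdeleRing` in the field, absent from the Mathlib pin (recorded in the tenure notes
  of lang.S23).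

## References

* J. Arthur, L. Clozel, *Simple algebras, base change, and the advanced theory of the trace
  formula*, Ann. of Math. Stud. 120 (1989), Ch. 3, proof of Thm. 3.1 (p. 172) [ArthurClozelAMS120].
* A. Borel, H. Jacquet, *Automorphic forms and automorphic representations*, Corvallis (1979),
  Part 1, §4.6 [BorelJacquetCorvallis1979].
* J. Tate, *Fourier analysis in number fields and Hecke's zeta-functions*, in Cassels–Fröhlich
  (1967), Ch. XV, §2.3, §2.5 (unramified quasi-characters, value at a uniformizer) [TateThesis1967].
-/

noncomputable section

open scoped MatrixGroups
open NumberField IsDedekindDomain MeasureTheory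

namespace ContRepresentation.ClosedSubrep

open Literature.NumberTheory.Automorphic Literature.NumberTheory.Automorphic.AdelicGroupData

section HeckeTwist

universe u

variable {K : Type} [Field K] [NumberField K] {𝒢 : AdelicGroupData.{u} K}
  {μ : Measure 𝒢.automorphicQuotient} [SMulInvariantMeasure 𝒢.Adelic 𝒢.automorphicQuotient μ]
  (W : ClosedSubrep (𝒢.rightRegular μ)) (ψ : 𝒢.AutomorphicCharacter)

/-- **`M_ψ` preserves `Kf`-fixed vectors when `ψ` is trivial on `Kf`**: `R(k)(ψ̄ f) = ψ(k)⁻¹ ψ̄ R(k) f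
= ψ̄ f`. [folklore] -/
theorem twistEquiv_mem_fixedVectors {Kf : Subgroup 𝒢.Adelic} (hψ : ∀ k ∈ Kf, ψ k = 1)
    {f : W.toSubmodule} (hf : f ∈ W.fixedVectors Kf) :
    W.twistEquiv ψ f ∈ (W.twist ψ).fixedVectors Kf := by
  rw [mem_fixedVectors] at hf ⊢
  intro x hx
  have h := W.isTwistedEquivariant_twistEquiv ψ x f
  dsimp only at h
  rw [hf x hx, hψ x hx, Units.val_one, one_smul] at h
  exact h.symm

/-- An automorphic character trivial on `Kf` is constant (`= ψ g`) on the double coset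
`Kf g Kf`, i.e. on every `x` with `x Kf ∈ Kf · g Kf`. [folklore] -/
theorem _root_.Literature.NumberTheory.Automorphic.AdelicGroupData.AutomorphicCharacter.apply_eq_of_mk_mem_orbit
    {Kf : Subgroup 𝒢.Adelic} (hψ : ∀ k ∈ Kf, ψ k = 1) {g x : 𝒢.Adelic}
    (hx : (x : 𝒢.Adelic ⧸ Kf) ∈ MulAction.orbit Kf (g : 𝒢.Adelic ⧸ Kf)) : ψ x = ψ g := by
  obtain ⟨⟨k, hk⟩, hkx⟩ := MulAction.mem_orbit_iff.mp hx
  change (((k * g : 𝒢.Adelic)) : 𝒢.Adelic ⧸ Kf) = (x : 𝒢.Adelic ⧸ Kf) at hkx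
  rw [QuotientGroup.eq] at hkx
  have h1 := hψ _ hkx
  rw [map_mul, map_inv, map_mul, hψ k hk, one_mul, inv_mul_eq_one] at h1
  exact h1.symm

/-- **Hecke operators of the twist.** For `ψ` trivial on the level `Kf` and a `Kf`-fixed
`f ∈ W`: `[Kf g Kf] (ψ̄ f) = ψ(g)⁻¹ ψ̄ ([Kf g Kf] f)` in `M_ψ(W)` — each summand `R(x) (ψ̄ f)`,
`x Kf ⊆ Kf g Kf`, equals `ψ(x)⁻¹ ψ̄ R(x) f` and `ψ(x) = ψ(g)` (`apply_eq_of_mk_mem_orbit`); in the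
junk case of an infinite double coset both sides vanish (`heckeOperator_eq_zero_of_infinite`).
This is the computation behind `t_{π ⊗ χ, v} = χ(ϖ_v) t_{π,v}` (Arthur–Clozel (1989), Ch. 3, proof
of Thm. 3.1, p. 172). [folklore] -/
theorem heckeOperatorAt_twist_twistEquiv {Kf : Subgroup 𝒢.Adelic} (hψ : ∀ k ∈ Kf, ψ k = 1)
    (g : 𝒢.Adelic) {f : W.toSubmodule} (hf : f ∈ W.fixedVectors Kf) :
    heckeOperatorAt (W.twist ψ) Kf g (W.twistEquiv ψ f) =
      ((ψ g : ℂˣ) : ℂ)⁻¹ • W.twistEquiv ψ (heckeOperatorAt W Kf g f) := by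
  classical
  have hE := W.isTwistedEquivariant_twistEquiv ψ
  -- termwise: `ρ'(x) (E f) = ψ(x)⁻¹ • E (ρ(x) f)`
  have hterm : ∀ x : 𝒢.Adelic, (W.twist ψ).toContRep x (W.twistEquiv ψ f) =
      ((ψ x : ℂˣ) : ℂ)⁻¹ • W.twistEquiv ψ (W.toContRep x f) := by
    intro x
    rw [hE x f, smul_smul, inv_mul_cancel₀ (Units.ne_zero _), one_smul]
  by_cases hfin : (MulAction.orbit Kf (g : 𝒢.Adelic ⧸ Kf)).Finite
  · set s : Finset 𝒢.Adelic := hfin.toFinset.image Quotient.out with hs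
    have hbij : Set.BijOn (fun x : 𝒢.Adelic => (x : 𝒢.Adelic ⧸ Kf)) s
        (MulAction.orbit Kf (g : 𝒢.Adelic ⧸ Kf)) := by
      refine ⟨?_, ?_, ?_⟩
      · intro x hx
        obtain ⟨y, hy, rfl⟩ := Finset.mem_image.1 hx
        rw [Set.Finite.mem_toFinset] at hy
        simpa only [QuotientGroup.out_eq'] using hy
      · intro x hx x' hx' h
        obtain ⟨y, -, rfl⟩ := Finset.mem_image.1 hx
        obtain ⟨y', -, rfl⟩ := Finset.mem_image.1 hx'
        simp only [QuotientGroup.out_eq'] at h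
        rw [h]
      · intro y hy
        refine ⟨y.out, Finset.mem_image.2 ⟨y, (Set.Finite.mem_toFinset _).2 hy, rfl⟩, ?_⟩
        exact QuotientGroup.out_eq' y
    have hf' := W.twistEquiv_mem_fixedVectors ψ hψ hf
    rw [heckeOperatorAt, heckeOperatorAt,
      heckeOperator_apply_eq_sum _ Kf g s hbij hf', heckeOperator_apply_eq_sum _ Kf g s hbij hf,
      map_sum, Finset.smul_sum]
    refine Finset.sum_congr rfl fun x hx => ?_
    change (W.twist ψ).toContRep x (W.twistEquiv ψ f) = _ • W.twistEquiv ψ (W.toContRep x f)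
    rw [hterm x, ψ.apply_eq_of_mk_mem_orbit hψ (hbij.mapsTo hx)]
  · have hinf : (MulAction.orbit Kf (g : 𝒢.Adelic ⧸ Kf)).Infinite := hfin
    rw [heckeOperatorAt, heckeOperatorAt, heckeOperator_eq_zero_of_infinite _ Kf g hinf,
      heckeOperator_eq_zero_of_infinite _ Kf g hinf, LinearMap.zero_apply, LinearMap.zero_apply,
      map_zero, smul_zero]

end HeckeTwist

end ContRepresentation.ClosedSubrep

namespace Literature.NumberTheory.Automorphic

open AdelicGroupData

/-! ### `GL_n`: Satake parameters of `M_ψ(W)` and of `π ⊗ χ` -/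

section SatakeTwist

variable {n : ℕ} {K : Type} [Field K] [NumberField K]

/-- `e_i(c · α) = cⁱ e_i(α)` (homogeneity of the elementary symmetric functions; the `*`-form of
Mathlib's `Multiset.pow_smul_esymm`). [folklore] -/
theorem esymm_map_const_mul {R : Type*} [CommSemiring R] (s : Multiset R) (c : R) (k : ℕ) :
    (s.map (c * ·)).esymm k = c ^ k * s.esymm k :=
  (Multiset.pow_smul_esymm c k s).symm

variable {μ : Measure (gl n K).automorphicQuotient}
  [SMulInvariantMeasure (gl n K).Adelic (gl n K).automorphicQuotient μ]

/-- **Satake parameters of a twist `M_ψ(W)`.** If `W` has Satake parameter `α` at `v` with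
respect to a level `Kf` on which `ψ` is trivial, and `ψ(t_{v,i}) = z^i` for `0 ≤ i ≤ n` (e.g.
`ψ = χ ∘ det`, `z = χ(ϖ_v)`), then `M_ψ(W)` has Satake parameter `z⁻¹ α` at `v` (same level, same
uniformizer): `[Kf t_{v,i} Kf] (ψ̄ f) = z^{-i} q_v^{i(n-i)/2} e_i(α) ψ̄ f` and
`z^{-i} e_i(α) = e_i(z⁻¹ α)` (`heckeOperatorAt_twist_twistEquiv`, `esymm_map_const_mul`).
[folklore] -/
theorem HasSatakeParameterAt.twist
    {W : ContRepresentation.ClosedSubrep ((gl n K).rightRegular μ)}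
    {Kf : Subgroup (GL (Fin n) (AdeleRing (𝓞 K) K))} {v : HeightOneSpectrum (𝓞 K)}
    {ϖ : (v.adicCompletion K)ˣ} {α : Multiset ℂ} (h : HasSatakeParameterAt W Kf v ϖ α)
    (ψ : (gl n K).AutomorphicCharacter) (hψ : ∀ k ∈ Kf, ψ k = 1) {z : ℂ}
    (hz : ∀ i ≤ n, ((ψ (heckeDiagAt n K v ϖ i) : ℂˣ) : ℂ) = z ^ i) :
    HasSatakeParameterAt (W.twist ψ) Kf v ϖ (α.map (z⁻¹ * ·)) := by
  obtain ⟨hϖ, hcard, f, hf, hf0, hT⟩ := h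
  refine ⟨hϖ, by rw [Multiset.card_map, hcard], W.twistEquiv ψ f,
    W.twistEquiv_mem_fixedVectors ψ hψ hf, ?_, fun i hi => ?_⟩
  · exact fun h0 => hf0 ((W.twistEquiv ψ).injective (by rw [h0, map_zero]))
  · rw [W.heckeOperatorAt_twist_twistEquiv ψ hψ _ hf, hT i hi, map_smul, smul_smul, hz i hi,
      esymm_map_const_mul, inv_pow]
    ring_nf

/-- `det (diag d) = ∏ d`. [folklore] -/
theorem det_glDiagonal {R : Type*} [CommRing R] (d : Fin n → Rˣ) :
    Matrix.GeneralLinearGroup.det (glDiagonal n R d) = ∏ k, d k := by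
  refine Units.ext ?_
  change (glDiagonal n R d : Matrix (Fin n) (Fin n) R).det = _
  rw [coe_glDiagonal, Matrix.det_diagonal, Units.coe_prod]

/-- The local idele of `ϖ` at `v` built in `GLnAdelicStructure` (`uniformizerIdele`, then the
inclusion of the finite ideles) is `localUnits v ϖ` of `HeckeCharacter`. [folklore] -/
theorem map_inr_uniformizerIdele (v : HeightOneSpectrum (𝓞 K)) (ϖ : (v.adicCompletion K)ˣ) :
    Units.map (MonoidHom.inr (InfiniteAdeleRing K) (FiniteAdeleRing (𝓞 K) K) :
        FiniteAdeleRing (𝓞 K) K →* AdeleRing (𝓞 K) K) (uniformizerIdele K v ϖ) =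
      Literature.NumberTheory.GaloisRepresentations.localUnits v ϖ :=
  Units.ext rfl

/-- **`det t_{v,i} = ϖ_v^i`** (as ideles: `ϖ^i` at `v`, `1` elsewhere), for `i ≤ n`. [folklore] -/
theorem det_heckeDiagAt (v : HeightOneSpectrum (𝓞 K)) (ϖ : (v.adicCompletion K)ˣ) {i : ℕ}
    (hi : i ≤ n) :
    Matrix.GeneralLinearGroup.det (heckeDiagAt n K v ϖ i) = Literature.NumberTheory.GaloisRepresentations.localUnits v ϖ ^ i := by
  rw [heckeDiagAt, det_glDiagonal, ← map_inr_uniformizerIdele]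
  set U : (AdeleRing (𝓞 K) K)ˣ := Units.map (MonoidHom.inr (InfiniteAdeleRing K)
    (FiniteAdeleRing (𝓞 K) K) : FiniteAdeleRing (𝓞 K) K →* AdeleRing (𝓞 K) K) (uniformizerIdele K v ϖ)
  rw [Fin.prod_univ_eq_prod_range (fun k => if k < i then U else 1) n,
    ← Finset.prod_range_mul_prod_Ico _ hi]
  rw [Finset.prod_eq_one (s := Finset.Ico i n) fun k hk => if_neg (not_lt.mpr (Finset.mem_Ico.mp hk).1),
    mul_one, Finset.prod_congr rfl fun k hk => if_pos (Finset.mem_range.mp hk), Finset.prod_const,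
    Finset.card_range]

/-- **`det (ι_v(g)) = (det g)_v`**: the determinant of the local embedding `GL_n(K_v) → GL_n(𝔸_K)`
is the local idele of `det g` (componentwise: `det g` at `v`, `1` at `w ≠ v` and at infinity).
[folklore] -/
theorem GLn.det_ofLocal (v : HeightOneSpectrum (𝓞 K)) (g : GL (Fin n) (v.adicCompletion K)) :
    Matrix.GeneralLinearGroup.det (GLn.ofLocal n K v g) =
      Literature.NumberTheory.GaloisRepresentations.localUnits v (Matrix.GeneralLinearGroup.det g) := by
  refine Units.ext (Prod.ext ?_ (FiniteAdeleRing.ext K fun w => ?_))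
  · -- archimedean component
    change ((GLn.ofLocal n K v g : Matrix (Fin n) (Fin n) (AdeleRing (𝓞 K) K)).det).1 = 1
    have : ((GLn.ofLocal n K v g : Matrix (Fin n) (Fin n) (AdeleRing (𝓞 K) K)).det).1 =
        ((RingHom.fst (InfiniteAdeleRing K) (FiniteAdeleRing (𝓞 K) K)).mapMatrix
          (GLn.ofLocal n K v g : Matrix (Fin n) (Fin n) (AdeleRing (𝓞 K) K))).det := by
      rw [← RingHom.map_det]; rfl
    rw [this]
    have h1 : (RingHom.fst (InfiniteAdeleRing K) (FiniteAdeleRing (𝓞 K) K)).mapMatrix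
        (GLn.ofLocal n K v g : Matrix (Fin n) (Fin n) (AdeleRing (𝓞 K) K)) = 1 := by
      ext i j
      exact GLn.fst_coe_ofLocal_apply g i j
    rw [h1, Matrix.det_one]
  · -- finite components
    change (((GLn.ofLocal n K v g : Matrix (Fin n) (Fin n) (AdeleRing (𝓞 K) K)).det).2) w =
      ((Literature.NumberTheory.GaloisRepresentations.localUnits v (Matrix.GeneralLinearGroup.det g) : AdeleRing (𝓞 K) K).2) w
    have : (((GLn.ofLocal n K v g : Matrix (Fin n) (Fin n) (AdeleRing (𝓞 K) K)).det).2) w =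
        (Matrix.GeneralLinearGroup.map (AdelicGroupData.adeleEval K w) (GLn.ofLocal n K v g) :
          Matrix (Fin n) (Fin n) (w.adicCompletion K)).det := by
      change AdelicGroupData.adeleEval K w _ = _
      rw [RingHom.map_det]; rfl
    rw [this]
    by_cases hw : w = v
    · subst hw
      rw [show Matrix.GeneralLinearGroup.map (AdelicGroupData.adeleEval K w) (GLn.ofLocal n K w g) = g
        from GLn.toLocal_ofLocal g]
      exact (Literature.NumberTheory.GaloisRepresentations.localUnits_snd_apply_self w (Matrix.GeneralLinearGroup.det g)).symm
    · rw [show Matrix.GeneralLinearGroup.map (AdelicGroupData.adeleEval K w) (GLn.ofLocal n K v g) = 1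
        from GLn.toLocal_ofLocal_of_ne hw g, Units.val_one, Matrix.det_one]
      exact (Literature.NumberTheory.GaloisRepresentations.finiteAdeleSingle_apply_of_ne _ hw).symm

/-- **A Hecke character of level `𝔪` is unramified outside `𝔪`**: if `χ ∘ det` is trivial on the
principal congruence subgroup `K(𝔪)` of `GL_n(𝔸_K)` (`n ≥ 1`, `𝔪 ≠ 0`) and `v ∤ 𝔪`, then `χ_v`
is trivial on `𝒪_vˣ` (`K(𝔪) ⊇ ι_v(GL_n(𝒪_v)) ∋ ι_v(diag(u,1,…,1))`, of determinant the local
idele of `u`). [folklore] -/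
theorem _root_.Literature.NumberTheory.GaloisRepresentations.HeckeCharacter.isUnramifiedAt_of_level (hn : 0 < n) (χ : Literature.NumberTheory.GaloisRepresentations.HeckeCharacter K)
    {𝔪 : Ideal (𝓞 K)} (h𝔪 : 𝔪 ≠ 0)
    (hχ𝔪 : ∀ k ∈ principalCongruenceLevel n K 𝔪, χ (Matrix.GeneralLinearGroup.det k) = 1)
    {v : HeightOneSpectrum (𝓞 K)} (hv : ¬ v.asIdeal ∣ 𝔪) : χ.IsUnramifiedAt v := by
  intro u
  set u' : (v.adicCompletion K)ˣ := Units.map ((v.adicCompletionIntegers K).subtype : _ →* _) u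
  set d : Fin n → (v.adicCompletion K)ˣ := fun k => if k = ⟨0, hn⟩ then u' else 1 with hd
  have hdmem : glDiagonal n (v.adicCompletion K) d ∈
      valuedCongruenceSubgroup (Fin n) (1 : WithZero (Multiplicative ℤ)) := by
    refine glDiagonal_mem_valuedCongruenceSubgroup_one (fun k => ?_) fun k => ?_
    · by_cases hk : k = ⟨0, hn⟩
      · rw [hd]; dsimp only; rw [if_pos hk]; exact u.1.2
      · rw [hd]; dsimp only; rw [if_neg hk, Units.val_one, map_one]
    · by_cases hk : k = ⟨0, hn⟩
      · rw [hd]; dsimp only; rw [if_pos hk]; exact u⁻¹.1.2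
      · rw [hd]; dsimp only; rw [if_neg hk, inv_one, Units.val_one, map_one]
  have hmem : GLn.ofLocal n K v (glDiagonal n (v.adicCompletion K) d) ∈
      principalCongruenceLevel n K 𝔪 :=
    isMaximalAt_principalCongruenceLevel n K v h𝔪 hv ⟨_, hdmem, rfl⟩
  have := hχ𝔪 _ hmem
  rw [GLn.det_ofLocal, det_glDiagonal, Fintype.prod_ite_eq'] at this
  simpa only [Literature.NumberTheory.GaloisRepresentations.HeckeCharacter.localComponent_apply] using this

/-- **Satake parameters of `π ⊗ χ`** (Arthur–Clozel (1989), Ch. 3, proof of Thm. 3.1, p. 172: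
the local factor of `L^S(s, π ⊗ π̃' ⊗ ηⁱ)` is `det(1 - t_v ⊗ t̃'_v ζ_vⁱ q_v^{-s})⁻¹` with
`ζ_v = η(ϖ_v)`, i.e. `t_{π ⊗ η, v} = η(ϖ_v) t_{π,v}`). If the cuspidal `π` has Satake parameter `α`
at `v` with respect to `K(𝔫)` and `χ ∘ det` is trivial on `K(𝔫)`, then `π ⊗ χ` has Satake
parameter `χ_v(ϖ) · α` at `v` with respect to `K(𝔫)` and the same uniformizer `ϖ`.
[cite: ArthurClozelAMS120, Ch. 3, proof of Thm. 3.1 (p. 172)] -/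
theorem CuspidalAutomorphicRepGL.hasSatakeParameterAt_twistByChar (P : CuspidalAutomorphicRepGL n K μ)
    (χ : Literature.NumberTheory.GaloisRepresentations.HeckeCharacter K) (hχ : χ.IsUnitary) (hχ₀ : ∀ t, χ (posRealIdele K t) = 1)
    {𝔫 : Ideal (𝓞 K)} (hχ𝔫 : ∀ k ∈ principalCongruenceLevel n K 𝔫, χ (Matrix.GeneralLinearGroup.det k) = 1)
    {v : HeightOneSpectrum (𝓞 K)} {ϖ : (v.adicCompletion K)ˣ} {α : Multiset ℂ}
    (h : HasSatakeParameterAt P.1 (principalCongruenceLevel n K 𝔫) v ϖ α) :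
    HasSatakeParameterAt (P.twistByChar χ hχ hχ₀).1 (principalCongruenceLevel n K 𝔫) v ϖ
      (α.map (((χ (Literature.NumberTheory.GaloisRepresentations.localUnits v ϖ) : ℂˣ) : ℂ) * ·)) := by
  have key := h.twist (detChar χ hχ hχ₀)⁻¹
    (fun k hk => by rw [AutomorphicCharacter.inv_apply, detChar_apply, hχ𝔫 k hk, inv_one])
    (z := ((χ (Literature.NumberTheory.GaloisRepresentations.localUnits v ϖ) : ℂˣ) : ℂ)⁻¹) (fun i hi => by
      rw [AutomorphicCharacter.coe_inv_apply, detChar_apply, det_heckeDiagAt v ϖ hi, map_pow,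
        Units.val_pow_eq_pow_val, inv_pow])
  rw [inv_inv] at key
  exact key

end SatakeTwist

section SatakeFamilyTwist

variable {n : ℕ} {K : Type} [Field K] [NumberField K]
  {μ : Measure (gl n K).automorphicQuotient} [(gl n K).IsAutomorphicMeasure μ]

/-- **The Satake family of `π ⊗ χ` is `v ↦ χ(ϖ_v) t_{π,v}`** away from `S`, for `χ` of level `𝔪`
(`χ ∘ det` trivial on `K(𝔪)`, `𝔪 ≠ 0`) and `S` containing the primes of `𝔪`: from a Satake family
`α` of the cuspidal `π` away from `S` (`IsSatakeFamilyOf`) one gets the Satake family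
`v ↦ χ.valueAtUniformizer v · α v` of `π ⊗ χ` away from `S` (pass to the level `K(𝔫𝔪)`,
`HasSatakeParameterAt.of_level_le`; `χ` is unramified at `v ∤ 𝔪`,
`HeckeCharacter.isUnramifiedAt_of_level`, so `χ_v(ϖ) = χ.valueAtUniformizer v` for the
uniformizer `ϖ` of the witness). This is `t_{π ⊗ χ, v} = χ(ϖ_v) t_{π,v}` of Arthur–Clozel (1989),
Ch. 3, p. 172. [cite: ArthurClozelAMS120, Ch. 3, proof of Thm. 3.1 (p. 172)] -/
theorem IsSatakeFamilyOf.twistByChar {P : CuspidalAutomorphicRepGL n K μ}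
    {S : Set (HeightOneSpectrum (𝓞 K))} {α : SatakeFamily K} (hα : IsSatakeFamilyOf P S α)
    (χ : Literature.NumberTheory.GaloisRepresentations.HeckeCharacter K) (hχ : χ.IsUnitary) (hχ₀ : ∀ t, χ (posRealIdele K t) = 1)
    {𝔪 : Ideal (𝓞 K)} (h𝔪 : 𝔪 ≠ 0)
    (hχ𝔪 : ∀ k ∈ principalCongruenceLevel n K 𝔪, χ (Matrix.GeneralLinearGroup.det k) = 1)
    (hS : ∀ v ∉ S, ¬ v.asIdeal ∣ 𝔪) :
    IsSatakeFamilyOf (P.twistByChar χ hχ hχ₀) S fun v => (α v).map (χ.valueAtUniformizer v * ·) := by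
  intro v hv
  obtain ⟨𝔫, h𝔫, hv𝔫, ϖ, hϖ⟩ := hα v hv
  have h0 : 𝔫 * 𝔪 ≠ 0 := mul_ne_zero h𝔫 h𝔪
  have hv0 : ¬ v.asIdeal ∣ 𝔫 * 𝔪 := fun h => (v.prime.dvd_or_dvd h).elim hv𝔫 (hS v hv)
  have hϖ' := hϖ.of_level_le h0 Ideal.mul_le_right hv0
  have hχ' : ∀ k ∈ principalCongruenceLevel n K (𝔫 * 𝔪), χ (Matrix.GeneralLinearGroup.det k) = 1 :=
    fun k hk => hχ𝔪 k (principalCongruenceLevel_mono n K h0 Ideal.mul_le_left hk)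
  refine ⟨𝔫 * 𝔪, h0, hv0, ϖ, ?_⟩
  have key := P.hasSatakeParameterAt_twistByChar χ hχ hχ₀ hχ' hϖ'
  change HasSatakeParameterAt _ _ v ϖ ((α v).map (χ.valueAtUniformizer v * ·))
  rcases Nat.eq_zero_or_pos n with hn | hn
  · -- `n = 0`: the multiset is empty
    subst hn
    have hα0 : α v = 0 := Multiset.card_eq_zero.mp hϖ.card_eq
    rw [hα0, Multiset.map_zero] at key ⊢
    exact key
  · have hunr := χ.isUnramifiedAt_of_level hn h𝔪 hχ𝔪 (hS v hv)
    have hval : ((χ (Literature.NumberTheory.GaloisRepresentations.localUnits v ϖ) : ℂˣ) : ℂ) = χ.valueAtUniformizer v := by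
      rw [← Literature.NumberTheory.GaloisRepresentations.HeckeCharacter.localComponent_apply]
      exact Literature.NumberTheory.GaloisRepresentations.HeckeCharacter.localComponent_eq_valueAtUniformizer hunr hϖ.1
    rw [hval] at key
    exact key

end SatakeFamilyTwist

/-! ### Non-vanishing of Satake parameters and `π ⊗ η = π ⟹ η(ϖ_v)ⁿ = 1` -/

section Central

variable {n : ℕ} {K : Type} [Field K] [NumberField K]

/-- The Hecke operator of a **central** element `t` at any level `Kf` is just `ρ(t)` on
`Kf`-fixed vectors: `Kf t Kf = t Kf` is a single left coset. [folklore] -/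
theorem heckeOperator_apply_of_mem_center {k G V : Type*} [CommRing k] [Group G] [AddCommGroup V]
    [Module k V] (ρ : Representation k G V) (Kf : Subgroup G) {t : G} (ht : t ∈ Subgroup.center G)
    {v : V} (hv : v ∈ ρ.fixedPoints Kf) : heckeOperator ρ Kf t v = ρ t v := by
  classical
  have horb : MulAction.orbit Kf (t : G ⧸ Kf) = {(t : G ⧸ Kf)} := by
    ext y
    rw [Set.mem_singleton_iff]
    constructor
    · rintro ⟨⟨x, hx⟩, rfl⟩
      change (((x * t : G)) : G ⧸ Kf) = (t : G ⧸ Kf)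
      rw [Subgroup.mem_center_iff.mp ht x, QuotientGroup.eq, mul_inv_rev, inv_mul_cancel_right]
      exact Kf.inv_mem hx
    · rintro rfl
      exact MulAction.mem_orbit_self _
  have hbij : Set.BijOn (fun x : G => (x : G ⧸ Kf)) ({t} : Finset G) (MulAction.orbit Kf (t : G ⧸ Kf)) := by
    rw [horb, Finset.coe_singleton]
    exact Set.bijOn_singleton.mpr rfl
  rw [heckeOperator_apply_eq_sum ρ Kf t {t} hbij hv, Finset.sum_singleton]

/-- `t_{v,n} = ϖ · 1_n` (the local idele of `ϖ` on the whole diagonal) is **central** in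
`GL_n(𝔸_K)`. [folklore] -/
theorem heckeDiagAt_self_mem_center (v : HeightOneSpectrum (𝓞 K)) (ϖ : (v.adicCompletion K)ˣ) :
    heckeDiagAt n K v ϖ n ∈ Subgroup.center (GL (Fin n) (AdeleRing (𝓞 K) K)) := by
  set U : (AdeleRing (𝓞 K) K)ˣ := Units.map (MonoidHom.inr (InfiniteAdeleRing K)
    (FiniteAdeleRing (𝓞 K) K) : FiniteAdeleRing (𝓞 K) K →* AdeleRing (𝓞 K) K) (uniformizerIdele K v ϖ)
  have hval : (heckeDiagAt n K v ϖ n : Matrix (Fin n) (Fin n) (AdeleRing (𝓞 K) K)) =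
      (U : AdeleRing (𝓞 K) K) • (1 : Matrix (Fin n) (Fin n) (AdeleRing (𝓞 K) K)) := by
    rw [heckeDiagAt, coe_glDiagonal, Matrix.smul_one_eq_diagonal]
    refine congrArg Matrix.diagonal (funext fun k => ?_)
    rw [if_pos k.2]
  rw [Subgroup.mem_center_iff]
  intro g
  refine Units.ext ?_
  rw [Units.val_mul, Units.val_mul, hval, Matrix.mul_smul, Matrix.smul_mul, Matrix.mul_one,
    Matrix.one_mul]

variable {μ : Measure (gl n K).automorphicQuotient}
  [SMulInvariantMeasure (gl n K).Adelic (gl n K).automorphicQuotient μ]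

/-- **Satake parameters are non-zero**: if `W` has Satake parameter `α` at `v` (any level `Kf`),
then `e_n(α) = ∏ α ≠ 0`, i.e. `0 ∉ α`. Indeed `T_{v,n} = [Kf t_{v,n} Kf]` with `t_{v,n} = ϖ · 1`
central acts on the eigenvector `f ≠ 0` as the invertible operator `R(t_{v,n})`
(`heckeOperator_apply_of_mem_center`), with eigenvalue `q_v⁰ e_n(α) = e_n(α)`. [folklore] -/
theorem HasSatakeParameterAt.esymm_ne_zero
    {W : ContRepresentation.ClosedSubrep ((gl n K).rightRegular μ)}
    {Kf : Subgroup (GL (Fin n) (AdeleRing (𝓞 K) K))} {v : HeightOneSpectrum (𝓞 K)}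
    {ϖ : (v.adicCompletion K)ˣ} {α : Multiset ℂ} (h : HasSatakeParameterAt W Kf v ϖ α) :
    α.esymm n ≠ 0 := by
  obtain ⟨-, -, f, hf, hf0, hT⟩ := h
  intro h0
  have key := hT n le_rfl
  have e : heckeOperatorAt W Kf (heckeDiagAt n K v ϖ n) f = W.toContRep (heckeDiagAt n K v ϖ n) f :=
    heckeOperator_apply_of_mem_center _ Kf (heckeDiagAt_self_mem_center v ϖ) hf
  rw [h0, mul_zero, zero_smul, e] at key
  -- `R(t) f = 0` with `R(t)` injective forces `f = 0`
  apply hf0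
  have hinj : Function.Injective (W.toContRep (heckeDiagAt n K v ϖ n)) := by
    refine Function.LeftInverse.injective (g := W.toContRep (heckeDiagAt n K v ϖ n)⁻¹) fun a => ?_
    change (W.toContRep (heckeDiagAt n K v ϖ n)⁻¹ * W.toContRep (heckeDiagAt n K v ϖ n)) a = a
    rw [← map_mul, inv_mul_cancel, map_one]
    rfl
  exact hinj (key.trans (map_zero _).symm)

/-- All entries of a Satake parameter are non-zero (`e_n(α) = ∏ α ≠ 0`, `card α = n`). [folklore] -/
theorem HasSatakeParameterAt.zero_not_mem
    {W : ContRepresentation.ClosedSubrep ((gl n K).rightRegular μ)}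
    {Kf : Subgroup (GL (Fin n) (AdeleRing (𝓞 K) K))} {v : HeightOneSpectrum (𝓞 K)}
    {ϖ : (v.adicCompletion K)ˣ} {α : Multiset ℂ} (h : HasSatakeParameterAt W Kf v ϖ α) :
    (0 : ℂ) ∉ α := by
  intro h0
  apply h.esymm_ne_zero
  rw [← h.card_eq, Multiset.esymm, Multiset.powersetCard_self, Multiset.map_singleton,
    Multiset.sum_singleton]
  exact Multiset.prod_eq_zero h0

end Central

section CentralCuspidal

variable {n : ℕ} {K : Type} [Field K] [NumberField K]
  {μ : Measure (gl n K).automorphicQuotient} [(gl n K).IsAutomorphicMeasure μ]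

/-- **`π ⊗ η = π` forces `η(ϖ_v)ⁿ = 1` at the unramified places** (the Satake-parameter shadow of
the central-character identity `ω_π = ω_π ηⁿ`; it is how `π ≅ π ⊗ η` with `η` of prime order
`l` forces `l ∣ n` in Arthur–Clozel (1989), Ch. 3, Thm. 4.2 (b): "`Π₁` cuspidal of
`GL(n/l, 𝔸_E)`"). Precisely: under the named fact `Flath1979_heckeOperatorAt_ofLocal_eq_smul`
(uniqueness of Satake parameters at a level), if `η ∘ det` is trivial on `K(𝔪)` (`𝔪 ≠ 0`), the
cuspidal `π` satisfies `π ⊗ η = π` (equality in `L²_cusp`), and `π` has a Satake parameter at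
`v ∤ 𝔪` with respect to some `K(𝔫)`, `v ∤ 𝔫 ≠ 0`, then `η_v(ϖ)ⁿ = 1`: at level `K(𝔫𝔪)` both `α` and
`η_v(ϖ) α` are Satake parameters of `π = π ⊗ η` at `v`, hence equal, and `e_n(α) ≠ 0`.
[cite: ArthurClozelAMS120, Ch. 3, Thm. 4.2 (b) (p. 173)] -/
theorem CuspidalAutomorphicRepGL.pow_eq_one_of_twistByChar_eq
    (hF : Flath1979_heckeOperatorAt_ofLocal_eq_smul (n := n) (K := K) (μ := μ))
    (P : CuspidalAutomorphicRepGL n K μ) (η : Literature.NumberTheory.GaloisRepresentations.HeckeCharacter K) (hη : η.IsUnitary)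
    (hη₀ : ∀ t, η (posRealIdele K t) = 1) {𝔪 : Ideal (𝓞 K)} (h𝔪 : 𝔪 ≠ 0)
    (hη𝔪 : ∀ k ∈ principalCongruenceLevel n K 𝔪, η (Matrix.GeneralLinearGroup.det k) = 1)
    (heq : P.twistByChar η hη hη₀ = P) {𝔫 : Ideal (𝓞 K)} (h𝔫 : 𝔫 ≠ 0)
    {v : HeightOneSpectrum (𝓞 K)} (hv : ¬ v.asIdeal ∣ 𝔫) (hv𝔪 : ¬ v.asIdeal ∣ 𝔪)
    {ϖ : (v.adicCompletion K)ˣ} {α : Multiset ℂ}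
    (hα : HasSatakeParameterAt P.1 (principalCongruenceLevel n K 𝔫) v ϖ α) :
    ((η (Literature.NumberTheory.GaloisRepresentations.localUnits v ϖ) : ℂˣ) : ℂ) ^ n = 1 := by
  have h0 : 𝔫 * 𝔪 ≠ 0 := mul_ne_zero h𝔫 h𝔪
  have hv0 : ¬ v.asIdeal ∣ 𝔫 * 𝔪 := fun h => (v.prime.dvd_or_dvd h).elim hv hv𝔪
  have hα' := hα.of_level_le h0 Ideal.mul_le_right hv0
  have hη' : ∀ k ∈ principalCongruenceLevel n K (𝔫 * 𝔪), η (Matrix.GeneralLinearGroup.det k) = 1 :=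
    fun k hk => hη𝔪 k (principalCongruenceLevel_mono n K h0 Ideal.mul_le_left hk)
  have hβ := P.hasSatakeParameterAt_twistByChar η hη hη₀ hη' hα'
  rw [heq] at hβ
  set z : ℂ := ((η (Literature.NumberTheory.GaloisRepresentations.localUnits v ϖ) : ℂˣ) : ℂ) with hz
  have hαβ : α = α.map (z * ·) := HasSatakeParameterAt.unique_of_ofLocal_eq_smul hF P h0 hv0 hα' hβ
  have he : α.esymm n = z ^ n * α.esymm n := by
    conv_lhs => rw [hαβ]
    exact esymm_map_const_mul α z n
  have hne := hα.esymm_ne_zero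
  have : (z ^ n - 1) * α.esymm n = 0 := by rw [sub_mul, one_mul, ← he, sub_self]
  rcases mul_eq_zero.mp this with h1 | h1
  · exact sub_eq_zero.mp h1
  · exact absurd h1 hne

end CentralCuspidal

end Literature.NumberTheory.Automorphic
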